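import Mathlib
import Summits.HodgeConjecture.FermatCycles.HodgeFermatTheoremD6B

/-!
# PROPOSITION L7(c) (`tables/KR-FREE.md` §3) — unconditionally — part 1 (`HodgeFermat/PropL7c.lean`; HF-G22)

Tree copy (part 1 of 2) of the module `HodgeFermat/PropL7c.lean` of the sibling cell's standalone package
`run/shared/lean/pub/pub-hodgefermat/lean/HodgeFermat/` (394 lines, sha256 `20a93779212bc544…`), source lines 38–283 (§§1–2: the first-residue shift, the pointwise lemma `Z1Z1_seven_pointwise`, the type computation `Z1Z1_seven_type`).
Filed by cell `pub-hfermat`, seat prover-1 gen-3, on the COORDINATOR KEEPER RULING of 2026-08-25 (gem sweep H1: take the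
off-gate kernel theorem `thmFstar` through the gate) — here THEOREM F* of `tables/DPRIME-THEOREM.md` §9 IN FULL, i.e.
PROPOSITION D′(3N) and the descent (`HodgeFermat/PropDPrimeNFinal.lean`, GATE HF-G34), the last off-gate form of THEOREM F*
(its first two forms, `DecodingFinal.thmFstar` = F* at the prime levels and `ThmFstarNFinal.thmFstar` = F*(3N), landed on
2026-08-25 as `HodgeFermatThmFstar.lean` / `HodgeFermatThmFstarN.lean`, seats prover-1 gen-0 / gen-2); this file is one link of
the import closure of `PropDPrimeNFinal.propDprime` (the sibling's KR-free chain: THEOREM L, COROLLARY M, THEOREM D6,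
THEOREM U⁺, THEOREM KR6, THEOREM Z3U) on top of those landed chains.  The source module is the sibling's hub-checked module of
record (pub-hodgefermat `CERT.md` l.885, GATE HF-G22; cell record `check/PropL7c_standalone.lean` sha256 `1d93c4be2d9b15f4…`); its declarations are copied VERBATIM.
Deviations from the source module, exhaustively: the `import` lines (tree modules `Summits.HodgeConjecture.FermatCycles.
HodgeFermat*` instead of `HodgeFermat.*`); this module docstring; the three re-binding lines of `HodgeFermatBridge.lean`/`HodgeFermatTheoremD6A.lean` (`open HodgeFermat.KRFree.Decoding renaming st_symm → sameType_symm, st_trans → sameType_trans, st_swap → sameType_swap, st_rot → sameType_rot, unit_mul_not_dvd → not_dvd_unit_mul`, `open HodgeFermat.KRFree.Decoding (rsum_swap rsum_rot)`, `open HodgeFermat.KRFree.TheoremZ3U renaming not_dvd_cofactor' → not_dvd_cofactor, rsum_const₃ → rsum_const_of_dvd`) are added because this module used those deleted `Bridge`/`TheoremD6`/`TheoremL` copies through its `open` line; DEDUP (pre-empting the gate's `dedup.landed`): the source's `res_neg` (l.139–154), `rsum_neg` (l.156–164), `coprime_neg` (l.166–168) are VERBATIM (up to names) the primed lemmas `res_neg'`,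 `rsum_neg'`, `coprime_neg'` of `HodgeFermatTheoremZ3UA.lean` and are DELETED, re-bound by the added line `open HodgeFermat.KRFree.TheoremZ3U renaming res_neg' → res_neg, rsum_neg' → rsum_neg, coprime_neg' → coprime_neg`; the file ends at source l.283 with an `end` line (part 2 = `HodgeFermatPropL7cB.lean`).
Every other line — in particular every declaration's statement and proof — is byte-identical to the source.
HONEST FRAMING: explicit algebraic cycles for specific Hodge classes on Fermat/Delsarte varieties; residual open instances
listed; no claim on general Hodge.  (This file is arithmetic of CM types / finite combinatorics / analytic number theory
of the sibling's KR-free programme; it claims nothing about cycles.)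

The source module's docstring (PropL7c.lean l.3–36), verbatim:

## PROPOSITION L7(c) (`tables/KR-FREE.md` §3) — unconditionally — and THEOREM D6 modulo THEOREM U

`TheoremD6.lean` proves `theoremD6_of : PropL7c → ThmU → D6`, with PROPOSITION L7(c) — "(Z1, Z1) at the prime 7
does not occur at squarefree levels prime to 6" — as a named hypothesis.  Generation 21 kernel-checked L7(c) down
to LEMMA CC (`tables/KR-FREE.md` §2, class containment, proved by hand with the odd quartic character mod 5).
This file REMOVES LEMMA CC: L7(c) is kernel-checked outright, so THEOREM D6 holds modulo THEOREM U alone.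

The new move (§2) is the same as generation 21's for L7(a): the level-`n` CM type of `T̄ = T mod n` is identified
COMPLETELY with that of an explicit Z3 triple, instead of only on one class mod 5.  With `n = 5g`,
`y − y' ≡ g v (mod n)`, `5 ∤ v`:

* §1 (generation 21, verbatim) `Z1Z1_seven_pointwise` : at a unit `t₀` with `t₀ v ≡ 2 (mod 5)` and `7 t₁ ≡ t₀`
  the carries are `c_T̄(t₀) = 1`, `c_T̄(t₁) = 2` (fibre identity (E) of LEMMA N);
* §2 `Z1Z1_seven_type` : hence `c_T̄(t) = 1` on the class `tv ≡ 2`, `c_T̄(t) = 2` on the class `tv ≡ 1` (take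
  `t₀ = 7t`, `t₁ = t`: `7tv ≡ 2`), and by the NEGATION SYMMETRY `c_T̄(−t) = 3 − c_T̄(t)` (`res_neg`, `rsum_neg`;
  `−1 ≡ 4 (mod 5)`) `c_T̄ = 2` on `tv ≡ 3` and `c_T̄ = 1` on `tv ≡ 4`.  So `H_T̄ = {t : tv mod 5 ∈ {2, 4}}`, which is
  exactly `H_V` for the Z3-at-`g` triple `V = g·(3v, 3v, 9v)` of level `n` (`⟨t·3gv⟩_n = g·(3tv mod 5)`):
  `T̄ ∼ V` at level `n`, and `T̄` has no zero entry (two units with different carries, `rsum_const_of_dvd`);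
* §3 `propL7c : PropL7c` : the (Z1,Z1) row at 7 with `3 ∤ n` (`row_Z1Z1_seven_not3`) gives `n = 5g`,
  `g = gcd(y − y', n)`, `y − y' ≡ g v`, `5 ∤ v`.  If `g = 1` then `N = 35` and F35 (`coincidenceFree_first`)
  contradicts disjointness / `7 ∤ x₂' x₃'`.  If `g > 1`, take a prime `q ∣ g` (`q ≥ 11` as `N` is squarefree and
  prime to 6): EITHER `q ∣ 7y, x₂, x₃` — then `T` is a Z3 triple at `q` at level `7n` while `T'` is not (joint
  primitivity), impossible by `z3_vs_any` — OR not — then `V` is a Z3 triple at `q` at level `n = q·(5g/q)` while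
  `T̄ ∼ V` is not, impossible by `z3_vs_any` again;
* `theoremD6_of_U : ThmU → D6`.

So THEOREM D6 (no disjoint coincidence of CM types at a squarefree level prime to 6) is kernel-checked modulo
exactly THEOREM U (`tables/SEMI-THEOREM.md` §2, the all-unit case, in the form `ThmU`).
No `sorry`, no `native_decide`; axioms `propext`, `Classical.choice`, `Quot.sound` only.
(No instance of the hypotheses of `Z1Z1_seven_type` exists at small `n` — a search over `n ≤ 40` found none,
consistently with the theorem —, so §2 is exercised by the planted false variants of `check/README.md` rather than
by a kernel example.)
-/

set_option autoImplicit false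

namespace HodgeFermat.KRFree.PropL7c

open HodgeFermat.KRFree HodgeFermat.KRFree.LemmaN HodgeFermat.KRFree.LemmaO HodgeFermat.KRFree.TheoremL
  HodgeFermat.KRFree.Bridge HodgeFermat.KRFree.TheoremD6
open HodgeFermat.KRFree.Decoding renaming st_symm → sameType_symm, st_trans → sameType_trans, st_swap → sameType_swap, st_rot → sameType_rot, unit_mul_not_dvd → not_dvd_unit_mul
open HodgeFermat.KRFree.Decoding (rsum_swap rsum_rot)
open HodgeFermat.KRFree.TheoremZ3U renaming not_dvd_cofactor' → not_dvd_cofactor, rsum_const₃ → rsum_const_of_dvd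
open HodgeFermat.KRFree.TheoremZ3U renaming res_neg' → res_neg, rsum_neg' → rsum_neg, coprime_neg' → coprime_neg


/-! ## §1  Pointwise analysis of a (Z1, Z1) pair at `p = 7`, `n = 5g` (generation 21) -/

/-- the carry sum of a triple whose FIRST entry is non-zero at the unit `t` is `n` or `2n` -/
lemma rsum_cases_first {n a b c t : ℕ} (hn : 0 < n) (hs : n ∣ a + b + c) (ha : ¬ n ∣ t * a) :
    rsum n (a, b, c) t = n ∨ rsum n (a, b, c) t = 2 * n := by
  have hs' : n ∣ b + c + a := by rwa [show b + c + a = a + b + c by ring]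
  have h := (rsum_cases hn hs' ha).1
  rw [← rsum_rot n b c a t] at h
  exact h

/-- the first residues: `y − y' ≡ g v (mod n)`, `n = 5g`, `t v ≡ 2 (mod 5)` ⟹ `⟨ty⟩_n ≡ ⟨ty'⟩_n + 2g (mod n)`,
i.e. `⟨ty⟩ = ⟨ty'⟩ + 2g` or `⟨ty⟩ = ⟨ty'⟩ − 3g` -/
lemma first_residue_shift (n g v y y' t : ℕ) (hn5 : n = 5 * g) (hg : 0 < g)
    (hzv : y + (n - 1) * y' = g * v) (hs2 : t * v % 5 = 2) :
    t * y % n = t * y' % n + 2 * g ∨ t * y % n + 3 * g = t * y' % n := by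
  obtain ⟨m, hm⟩ : ∃ m, n = m + 1 := ⟨n - 1, by omega⟩
  have hm1 : n - 1 = m := by omega
  rw [hm1] at hzv
  have hdv := Nat.div_add_mod (t * v) 5
  rw [hs2] at hdv
  -- t y + n (t y') = n Q + (2g + t y')
  have key : t * y + n * (t * y') = n * (t * v / 5) + (2 * g + t * y') := by
    calc t * y + n * (t * y') = t * (y + m * y') + t * y' := by rw [hm]; ring
      _ = g * (t * v) + t * y' := by rw [hzv]; ring
      _ = g * (5 * (t * v / 5) + 2) + t * y' := by rw [hdv]
      _ = n * (t * v / 5) + (2 * g + t * y') := by rw [hn5]; ring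
  have e : t * y % n = (2 * g + t * y') % n := by
    have h : (t * y + n * (t * y')) % n = (n * (t * v / 5) + (2 * g + t * y')) % n := by rw [key]
    rwa [Nat.add_mul_mod_self_left, Nat.add_comm (n * (t * v / 5)) _, Nat.add_mul_mod_self_left] at h
  have hn : 0 < n := by omega
  have h2g : 2 * g < n := by omega
  rw [Nat.add_mod, Nat.mod_eq_of_lt h2g] at e
  have bA' : t * y' % n < n := Nat.mod_lt _ hn
  rcases Nat.lt_or_ge (2 * g + t * y' % n) n with h | h
  · rw [Nat.mod_eq_of_lt h] at e
    left; omega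
  · have hlt2 : 2 * g + t * y' % n - n < n := by omega
    rw [Nat.mod_eq_sub_mod h, Nat.mod_eq_of_lt hlt2] at e
    right; omega

/-- **Pointwise analysis, (Z1,Z1) at 7.**  `T = (7y, x₂, x₃)`, `T' = (7y', x₂', x₃')` of the same CM type at level
`7n` (`7 ∤ n`, `7 ∤ x₂x₃x₂'x₃'`, `n ∤ y, y'`), `n = 5g`, `y − y' ≡ g v (mod n)`; `t₀` a unit of `ℤ/n` with
`t₀ v ≡ 2 (mod 5)` and `7 t₁ ≡ t₀`.  Then `c_T̄(t₀) = 1`, `c_T̄'(t₀) = 2`, `c_T̄(t₁) = 2`, `c_T̄'(t₁) = 1`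
(`rsum = n · c`).  [From (E): `n k₁ + R_T(t₀) + R_T'(t₁) = n k₁' + R_T'(t₀) + R_T(t₁)`; if `⟨t₀y⟩ = ⟨t₀y'⟩ + 2g`
then `n k₁ > 7⟨t₀y'⟩ + 9g ≥ n k₁' + 9g`, forcing the four carries; if `⟨t₀y⟩ = ⟨t₀y'⟩ − 3g` then
`n k₁' > n k₁ + 16 g`, impossible.] -/
theorem Z1Z1_seven_pointwise (n g v y x₂ x₃ y' x₂' x₃' t₀ t₁ : ℕ) (h7n : ¬ 7 ∣ n) (hn : 0 < n)
    (hs : 7 * n ∣ 7 * y + x₂ + x₃) (hx₂ : ¬ 7 ∣ x₂) (hx₃ : ¬ 7 ∣ x₃)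
    (hs' : 7 * n ∣ 7 * y' + x₂' + x₃') (hx₂' : ¬ 7 ∣ x₂') (hx₃' : ¬ 7 ∣ x₃')
    (hy : ¬ n ∣ y) (hy' : ¬ n ∣ y')
    (hn5 : n = 5 * g) (hzv : y + (n - 1) * y' = g * v)
    (ht₀ : Nat.Coprime t₀ n) (ht₁ : 7 * t₁ ≡ t₀ [MOD n]) (hs2 : t₀ * v % 5 = 2)
    (hH : SameType (7 * n) (7 * y, x₂, x₃) (7 * y', x₂', x₃')) :
    rsum n (7 * y, x₂, x₃) t₀ = n ∧ rsum n (7 * y', x₂', x₃') t₀ = 2 * n ∧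
      rsum n (7 * y, x₂, x₃) t₁ = 2 * n ∧ rsum n (7 * y', x₂', x₃') t₁ = n := by
  have hp : (7).Prime := by norm_num
  have h7cop : Nat.Coprime 7 n := (Nat.Prime.coprime_iff_not_dvd hp).mpr h7n
  have hg : 0 < g := by omega
  have ht₁u : Nat.Coprime t₁ n := coprime_t₁ ht₁ ht₀
  have hsn : n ∣ 7 * y + x₂ + x₃ := dvd_of_level hs
  have hsn' : n ∣ 7 * y' + x₂' + x₃' := dvd_of_level hs'
  -- the four carry sums are n or 2n
  have hR₀ := rsum_cases_first hn hsn (not_dvd_unit_mul ht₀ (not_dvd_unit_mul h7cop hy))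
  have hR₁ := rsum_cases_first hn hsn (not_dvd_unit_mul ht₁u (not_dvd_unit_mul h7cop hy))
  have hR₀' := rsum_cases_first hn hsn' (not_dvd_unit_mul ht₀ (not_dvd_unit_mul h7cop hy'))
  have hR₁' := rsum_cases_first hn hsn' (not_dvd_unit_mul ht₁u (not_dvd_unit_mul h7cop hy'))
  -- the fibre identity (E)
  have hE := fibre_identity_Z1Z1 7 n y x₂ x₃ y' x₂' x₃' t₀ t₁ hp h7n hn hs hx₂ hx₃ hs' hx₂' hx₃' ht₀ ht₁ hH
  -- the first residues and the carries k₁, k₁'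
  have hA := first_residue_shift n g v y y' t₀ hn5 hg hzv hs2
  have bA : t₀ * y % n < n := Nat.mod_lt _ hn
  have bA' : t₀ * y' % n < n := Nat.mod_lt _ hn
  have dA := Nat.div_add_mod (7 * (t₀ * y % n)) n
  have dA' := Nat.div_add_mod (7 * (t₀ * y' % n)) n
  have mA : 7 * (t₀ * y % n) % n < n := Nat.mod_lt _ hn
  have mA' : 7 * (t₀ * y' % n) % n < n := Nat.mod_lt _ hn
  generalize t₀ * y % n = A at *
  generalize t₀ * y' % n = A' at *
  generalize n * (7 * A / n) = K at *
  generalize n * (7 * A' / n) = K' at *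
  generalize 7 * A % n = r at *
  generalize 7 * A' % n = r' at *
  generalize rsum n (7 * y, x₂, x₃) t₀ = R₀ at *
  generalize rsum n (7 * y, x₂, x₃) t₁ = R₁ at *
  generalize rsum n (7 * y', x₂', x₃') t₀ = R₀' at *
  generalize rsum n (7 * y', x₂', x₃') t₁ = R₁' at *
  rcases hA with h4 | h4 <;> rcases hR₀ with h0 | h0 <;> rcases hR₁ with h1 | h1 <;>
    rcases hR₀' with h2 | h2 <;> rcases hR₁' with h3 | h3 <;>
    first
      | exact ⟨h0, h2, h1, h3⟩
      | (exfalso; omega)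

/-! ## §2  The negation symmetry, and the CM type of `T̄` at level `n` -/


/-- **The CM type of `T̄`, (Z1,Z1) at 7.**  Under the hypotheses of `Z1Z1_seven_pointwise` (with `5 ∤ v`), at level
`n = 5g`: `T̄ = (7y, x₂, x₃)` has no zero entry and the same CM type as the Z3-at-`g` triple `V = g·(3v, 3v, 9v)`,
i.e. `c_T̄(t) = 1 ⟺ tv mod 5 ∈ {2, 4}` — classes `tv ≡ 2, 1` by the pointwise analysis at `(t, 7⁻¹t)` resp.
`(7t, t)`, classes `tv ≡ 3, 4` by the negation symmetry `c(−t) = 3 − c(t)`. -/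
theorem Z1Z1_seven_type (n g v y x₂ x₃ y' x₂' x₃' : ℕ) (h7n : ¬ 7 ∣ n) (hn : 0 < n)
    (hs : 7 * n ∣ 7 * y + x₂ + x₃) (hx₂ : ¬ 7 ∣ x₂) (hx₃ : ¬ 7 ∣ x₃)
    (hs' : 7 * n ∣ 7 * y' + x₂' + x₃') (hx₂' : ¬ 7 ∣ x₂') (hx₃' : ¬ 7 ∣ x₃')
    (hy : ¬ n ∣ y) (hy' : ¬ n ∣ y')
    (hn5 : n = 5 * g) (hzv : y + (n - 1) * y' = g * v) (hv : Nat.Coprime v 5)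
    (hH : SameType (7 * n) (7 * y, x₂, x₃) (7 * y', x₂', x₃')) :
    ¬ n ∣ x₂ ∧ ¬ n ∣ x₃ ∧ SameType n (7 * y, x₂, x₃) (g * (3 * v), g * (3 * v), g * (9 * v)) := by
  have hp : (7).Prime := by norm_num
  have h7cop : Nat.Coprime 7 n := (Nat.Prime.coprime_iff_not_dvd hp).mpr h7n
  have hg : 0 < g := by omega
  have hsn : n ∣ 7 * y + x₂ + x₃ := dvd_of_level hs
  have hv5 : ¬ 5 ∣ v := (Nat.Prime.coprime_iff_not_dvd (by norm_num)).mp hv.symm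
  have nz₁ : ¬ n ∣ 7 * y := not_dvd_unit_mul h7cop hy
  -- a unit of ℤ/n lies in one of the four classes tv ≡ 1, 2, 3, 4 (mod 5)
  have hcl : ∀ t, Nat.Coprime t n → t * v % 5 = 1 ∨ t * v % 5 = 2 ∨ t * v % 5 = 3 ∨ t * v % 5 = 4 := by
    intro t ht
    have h5t : ¬ 5 ∣ t := by
      intro h
      have hd := Nat.dvd_gcd h (show 5 ∣ n from ⟨g, hn5⟩)
      rw [Nat.Coprime.gcd_eq_one ht] at hd
      omega
    have h5tv : ¬ 5 ∣ t * v := fun h => ((Nat.Prime.dvd_mul (by norm_num)).mp h).elim h5t hv5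
    omega
  -- class tv ≡ 2: carry 1 (pointwise analysis at t₀ = t)
  have cls2 : ∀ t, Nat.Coprime t n → t * v % 5 = 2 → rsum n (7 * y, x₂, x₃) t = n := by
    intro t ht htv
    obtain ⟨t₁, ht₁⟩ := exists_t₁ 7 n t hp h7n hn
    exact (Z1Z1_seven_pointwise n g v y x₂ x₃ y' x₂' x₃' t t₁ h7n hn hs hx₂ hx₃ hs' hx₂' hx₃' hy hy'
      hn5 hzv ht ht₁ htv hH).1
  -- class tv ≡ 1: carry 2 (pointwise analysis at t₀ = 7t, t₁ = t: 7tv ≡ 2)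
  have cls1 : ∀ t, Nat.Coprime t n → t * v % 5 = 1 → rsum n (7 * y, x₂, x₃) t = 2 * n := by
    intro t ht htv
    have h7t : Nat.Coprime (7 * t) n := Nat.Coprime.mul_left h7cop ht
    have h7tv : 7 * t * v % 5 = 2 := by rw [mul_assoc]; omega
    exact (Z1Z1_seven_pointwise n g v y x₂ x₃ y' x₂' x₃' (7 * t) t h7n hn hs hx₂ hx₃ hs' hx₂' hx₃' hy hy'
      hn5 hzv h7t (Nat.ModEq.refl _) h7tv hH).2.2.1
  -- two units with different carries (a class-2 unit among 1, 7, 49, 343 and its 7⁻¹-translate):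
  -- no entry of T̄ is ≡ 0 (mod n)
  obtain ⟨u, hu, huv⟩ : ∃ u, Nat.Coprime u n ∧ u * v % 5 = 2 := by
    have h49 : Nat.Coprime 49 n := by
      rw [show (49 : ℕ) = 7 * 7 by norm_num]; exact Nat.Coprime.mul_left h7cop h7cop
    have h343 : Nat.Coprime 343 n := by
      rw [show (343 : ℕ) = 7 * 49 by norm_num]; exact Nat.Coprime.mul_left h7cop h49
    rcases hcl 1 (Nat.coprime_one_left n) with h | h | h | h
    · exact ⟨7, h7cop, by omega⟩
    · exact ⟨1, Nat.coprime_one_left n, by omega⟩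
    · exact ⟨49, h49, by omega⟩
    · exact ⟨343, h343, by omega⟩
  obtain ⟨u₁, hu₁⟩ := exists_t₁ 7 n u hp h7n hn
  have hu₁u : Nat.Coprime u₁ n := coprime_t₁ hu₁ hu
  have P := Z1Z1_seven_pointwise n g v y x₂ x₃ y' x₂' x₃' u u₁ h7n hn hs hx₂ hx₃ hs' hx₂' hx₃' hy hy' hn5 hzv
    hu hu₁ huv hH
  have hc1 := P.1
  have hc2 := P.2.2.1
  have nz₂ : ¬ n ∣ x₂ := by
    intro hd
    have hs2 : n ∣ x₃ + 7 * y + x₂ := by rwa [show x₃ + 7 * y + x₂ = 7 * y + x₂ + x₃ by ring]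
    have hc := rsum_const_of_dvd hn hs2 hd hu hu₁u
    rw [rsum_rot n (7 * y) x₂ x₃ u, rsum_rot n (7 * y) x₂ x₃ u₁] at hc
    omega
  have nz₃ : ¬ n ∣ x₃ := by
    intro hd
    have hc := rsum_const_of_dvd hn hsn hd hu hu₁u
    omega
  refine ⟨nz₂, nz₃, ?_⟩
  -- the carry of T̄ at every unit t: c = 2, 1, 2, 1 on the classes tv ≡ 1, 2, 3, 4
  have carry : ∀ t, Nat.Coprime t n →
      (t * v % 5 = 1 → rsum n (7 * y, x₂, x₃) t = 2 * n) ∧ (t * v % 5 = 2 → rsum n (7 * y, x₂, x₃) t = n) ∧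
      (t * v % 5 = 3 → rsum n (7 * y, x₂, x₃) t = 2 * n) ∧ (t * v % 5 = 4 → rsum n (7 * y, x₂, x₃) t = n) := by
    intro t ht
    have hnt : Nat.Coprime ((n - 1) * t) n := coprime_neg hn ht
    have hneg := rsum_neg hn (not_dvd_unit_mul ht nz₁) (not_dvd_unit_mul ht nz₂) (not_dvd_unit_mul ht nz₃)
    have hn1 : (n - 1) % 5 = 4 := by omega
    have hcls : ∀ r, t * v % 5 = r → (n - 1) * t * v % 5 = 4 * r % 5 := by
      intro r hr
      rw [mul_assoc, Nat.mul_mod (n - 1) (t * v) 5, hn1, hr]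
    refine ⟨cls1 t ht, cls2 t ht, fun h3 => ?_, fun h4 => ?_⟩
    · -- −t lies in the class 2: c(−t) = 1, so c(t) = 2
      have h := cls2 ((n - 1) * t) hnt (by rw [hcls 3 h3])
      omega
    · -- −t lies in the class 1: c(−t) = 2, so c(t) = 1
      have h := cls1 ((n - 1) * t) hnt (by rw [hcls 4 h4])
      omega
  -- the type: c_T̄(t) = 1 ⟺ 2·g·(3tv mod 5) < 5g ⟺ t ∈ H_V
  intro t ht
  rw [inH_iff_rsum hn hsn ht nz₃]
  have eV : t * (g * (3 * v)) % n = g * (3 * (t * v) % 5) := by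
    rw [show t * (g * (3 * v)) = g * (3 * (t * v)) by ring, hn5, show 5 * g = g * 5 by ring,
      Nat.mul_mod_mul_left]
  show rsum n (7 * y, x₂, x₃) t = n ↔ t * (g * (3 * v)) % n + t * (g * (3 * v)) % n < n
  rw [eV]
  obtain ⟨c1, c2, c3, c4⟩ := carry t ht
  rcases hcl t ht with h | h | h | h
  · -- tv ≡ 1: carry 2; 3tv ≡ 3 and 6g ≥ 5g
    have hc := c1 h
    have e : 3 * (t * v) % 5 = 3 := by omega
    rw [e]; constructor <;> intro hh <;> omega
  · -- tv ≡ 2: carry 1; 3tv ≡ 1 and 2g < 5g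
    have hc := c2 h
    have e : 3 * (t * v) % 5 = 1 := by omega
    rw [e]; constructor <;> intro hh <;> omega
  · -- tv ≡ 3: carry 2; 3tv ≡ 4 and 8g ≥ 5g
    have hc := c3 h
    have e : 3 * (t * v) % 5 = 4 := by omega
    rw [e]; constructor <;> intro hh <;> omega
  · -- tv ≡ 4: carry 1; 3tv ≡ 2 and 4g < 5g
    have hc := c4 h
    have e : 3 * (t * v) % 5 = 2 := by omega
    rw [e]; constructor <;> intro hh <;> omega


end HodgeFermat.KRFree.PropL7c
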